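import Literature.NumberTheory.Sieve.GoldbachLinnikSixFloor
import Literature.NumberTheory.Sieve.GoldbachLinnikRomanovCertLower

/-!
# The `K = 6` floor of the Pintz–Ruzsa method at the TRUE constants `C₀ = twinPrimeConst`,
`R₀ = romanovConst`: no decimal hypothesis on `C₀`, `R₀`

Topic `Literature/NumberTheory/Sieve`; a LEAF over `GoldbachLinnikSixFloor.lean` (§1: the floor at `K = 6`
with the constants in print — `crit33_needs_Cstar_lt` assumes the printed decimals `0.66016 ≤ C₀` and
`1.93642 ≤ R₀`) and `GoldbachLinnikRomanovCertLower.lean` (kernel certificates `0.660135 ≤ twinPrimeConst`,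
`1.93665067 ≤ romanovConst`, hence `1.27845 ≤ twinPrimeConst · romanovConst`). Everything here is PROVED
(standard axioms); no named fact, no new numerics beyond `norm_num` on decimals.

**THIS IS NOT A ROUTE TO GOLDBACH; `K = 6` is NOT claimed, `K = 7` is NOT claimed** (the record in print is
`K = 8`, Pintz–Ruzsa II 2020; `K = 6` is known under GRH only, Johnston–Trudgian 2026). The statements are
FLOOR (necessity) statements about ONE criterion — Pintz–Ruzsa I §10 at the moment pair `(3, 3)`,
`(A₃ + Cλ⁴)² < 1` — and say what that criterion would REQUIRE; they do not assert that any requirement is met.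

* `crit33_not_lt_one_of_le`, `crit33_needs_C_lt_of_le` — SixFloor §1 with the threshold on the lacunary
  constant lowered from the printed value `0.789401` to `0.78940084`: still `2.576 · 0.78940084⁴ > 1.0003`, so
  the criterion needs `C < 2.576` for EVERY `λ ≥ 0.78940084`. (Why this threshold: the large-deviation method
  of Pintz–Ruzsa I §7 delivers, at exceptional-set exponent `N^{-3/5}`, exactly the `λ > d*(3/5) =
  inf_ξ (ψ(ξ) + (3/5) log 2)/ξ`; the reproduction cell `papers/Parity/linnik-goldbach-7` certifies numerically
  `0.7894008449785 ≤ d*(3/5) ≤ 0.7894008449787` (COMPARATORS §22) — NOT a tree theorem and not used below; it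
  only motivates stating the floor for all `λ ≥ 0.78940084`, a WEAKER hypothesis than SixFloor's.)
* `crit33_needs_Cstar_lt_of_prod` — the floor in product form: a mean-square constant of the Pintz–Ruzsa II
  Lemma 5 / Johnston–Trudgian (C2def1) shape `C ≥ C₀R₀ (C* − 1) + (1 − ϑ)(log 2)/2` with `C₀R₀ ≥ 1.27845` and
  level `ϑ ≤ 4/9` makes the `(3,3)` criterion need a pair-sieve constant `C* < 2.8644`.
* `crit33_needs_Cstar_lt_consts` — the same at `C₀R₀ := twinPrimeConst · romanovConst`, the product hypothesis
  being the tree theorem `twinPrimeConst_mul_romanovConst_window`: **granting any `λ ≥ 0.78940084`, any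
  `A₃ ≥ 0`, any level `ϑ ≤ 4/9` and a mean-square constant `C ≥ C₀R₀(C* − 1) + (1 − ϑ)(log 2)/2` at the TRUE
  `C₀, R₀`, the `K = 6` criterion `(A₃ + Cλ⁴)² < 1` forces `C* < 2.8644`** — against `3.9171` (Chen, print) and
  `3.3907` (Lichtman, preprint); Johnston–Trudgian print the matching sufficient value `C₁ = 2C* = 5.672`
  ("K = 6, no GRH"). Compared with `crit33_needs_Cstar_lt` the two printed decimals are gone from the
  hypotheses (the conclusion sharpens from `2.865` to `2.8644` because the certified product `1.27845` exceeds
  `0.66016 · 1.93642 = 1.27834`).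

## References

* J. Pintz, I. Z. Ruzsa, *On Linnik's approximation to Goldbach's problem, I*, Acta Arith. 109 (2003)
  169–194: §10 (10.10)–(10.16) (the criterion), Cor. 2 (`c₁ = 0.7894…`), (8.14), (8.16). [PintzRuzsa2003]
* J. Pintz, I. Z. Ruzsa, *On Linnik's approximation to Goldbach's problem, II*, Acta Math. Hungar. 161
  (2020) 569–582: Lemma 5 (the shape `C₀R₀C* + (log 2)/2`). [PintzRuzsa2020]
* D. R. Johnston, T. Trudgian, arXiv:2605.17825v2 (2026): (C2def1), Table `PRtable` row `K = 6`. [preprint]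
* Reproduction cell `papers/Parity/linnik-goldbach-7`, K6.md (floor statement), COMPARATORS.md §19, §22.
-/

noncomputable section

namespace Literature.NumberTheory.Sieve

namespace GoldbachLinnik

/-! ### §1 The floor for every `λ ≥ 0.78940084` -/

/-- For every `A₃ ≥ 0`, every mean-square constant `C ≥ 2.576` and every lacunary constant `λ ≥ 0.78940084`
the `(3, 3)` criterion quantity is NOT `< 1` (`2.576 · 0.78940084⁴ > 1.0003`). SixFloor's `crit33_not_lt_one`
is the case `λ ≥ 0.789401`. [folklore] -/
theorem crit33_not_lt_one_of_le {A₃ C lam : ℝ} (hA : 0 ≤ A₃) (hC : 2.576 ≤ C) (hlam : 0.78940084 ≤ lam) :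
    ¬ (A₃ + C * lam ^ (2 * 3 - 2)) * (A₃ + C * lam ^ (2 * 3 - 2)) < 1 := by
  have hl4 : (0.78940084 : ℝ) ^ 4 ≤ lam ^ 4 := pow_le_pow_left₀ (by norm_num) hlam 4
  have hCl : (2.576 : ℝ) * 0.78940084 ^ 4 ≤ C * lam ^ 4 :=
    mul_le_mul hC hl4 (by norm_num) (by linarith)
  have key : (1 : ℝ) ≤ A₃ + C * lam ^ 4 := by
    have : (1 : ℝ) ≤ (2.576 : ℝ) * 0.78940084 ^ 4 := by norm_num
    linarith
  have h4 : (2 * 3 - 2 : ℕ) = 4 := by norm_num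
  rw [h4, not_lt]
  exact one_le_mul_of_one_le_of_one_le key key

/-- The `K = 6` criterion with any `λ ≥ 0.78940084` and any `A₃ ≥ 0` NEEDS a mean-square constant `C < 2.576`.
[folklore] -/
theorem crit33_needs_C_lt_of_le {A₃ C lam : ℝ} (hA : 0 ≤ A₃) (hlam : 0.78940084 ≤ lam)
    (h : (A₃ + C * lam ^ (2 * 3 - 2)) * (A₃ + C * lam ^ (2 * 3 - 2)) < 1) : C < 2.576 := by
  by_contra hcon
  rw [not_lt] at hcon
  exact crit33_not_lt_one_of_le hA hcon hlam h

/-! ### §2 Product form and the floor at the true constants -/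

/-- **Floor, product form.** With any `A₃ ≥ 0`, any `λ ≥ 0.78940084`, a product `C₀R₀ ≥ 1.27845`, a level
`ϑ ≤ 4/9`, `C* ≥ 1` and a mean-square constant `C ≥ C₀R₀(C* − 1) + (1 − ϑ)(log 2)/2`, the `(3, 3)` criterion
`< 1` forces `C* < 2.8644`. [folklore] -/
theorem crit33_needs_Cstar_lt_of_prod {A₃ C lam C0R0 Cstar ϑ : ℝ} (hA : 0 ≤ A₃) (hlam : 0.78940084 ≤ lam)
    (hCR : 1.27845 ≤ C0R0) (hϑ : ϑ ≤ 4 / 9) (hCs : 1 ≤ Cstar)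
    (hC : C0R0 * (Cstar - 1) + Real.log 2 / 2 * (1 - ϑ) ≤ C)
    (h : (A₃ + C * lam ^ (2 * 3 - 2)) * (A₃ + C * lam ^ (2 * 3 - 2)) < 1) : Cstar < 2.8644 := by
  have hC' : C < 2.576 := crit33_needs_C_lt_of_le hA hlam h
  have hl : 0.6931471803 < Real.log 2 := Real.log_two_gt_d9
  have h1 : (1.27845 : ℝ) * (Cstar - 1) ≤ C0R0 * (Cstar - 1) :=
    mul_le_mul_of_nonneg_right hCR (by linarith)
  have h2 : (0.6931471803 : ℝ) / 2 * (5 / 9) ≤ Real.log 2 / 2 * (1 - ϑ) := by nlinarith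
  nlinarith

/-- **The `K = 6` floor at the TRUE constants** `C₀ = twinPrimeConst`, `R₀ = romanovConst` (no decimal
hypothesis on either: `1.27845 ≤ C₀R₀` is the tree theorem `twinPrimeConst_mul_romanovConst_window`).
Granting any lacunary constant `λ ≥ 0.78940084`, any `A₃ ≥ 0`, any major-arc level `ϑ ≤ 4/9`, `C* ≥ 1` and a
mean-square constant of the Lemma-5 / (C2def1) shape `C ≥ C₀R₀(C* − 1) + (1 − ϑ)(log 2)/2`, the `K = 6`
criterion `(A₃ + Cλ⁴)² < 1` of Pintz–Ruzsa I §10 forces a pair-sieve constant `C* < 2.8644` (print: Chen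
`3.9171`; preprint: Lichtman `3.3907`). NOT a route to Goldbach; `K = 6` NOT claimed. [folklore] -/
theorem crit33_needs_Cstar_lt_consts {A₃ C lam Cstar ϑ : ℝ} (hA : 0 ≤ A₃) (hlam : 0.78940084 ≤ lam)
    (hϑ : ϑ ≤ 4 / 9) (hCs : 1 ≤ Cstar)
    (hC : twinPrimeConst * romanovConst * (Cstar - 1) + Real.log 2 / 2 * (1 - ϑ) ≤ C)
    (h : (A₃ + C * lam ^ (2 * 3 - 2)) * (A₃ + C * lam ^ (2 * 3 - 2)) < 1) : Cstar < 2.8644 :=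
  crit33_needs_Cstar_lt_of_prod hA hlam twinPrimeConst_mul_romanovConst_window.1 hϑ hCs hC h

/-- The printed-threshold case (`λ ≥ 0.789401`, Pintz–Ruzsa I Cor. 2 as used in print and in-house) of
`crit33_needs_Cstar_lt_consts`. [folklore] -/
theorem crit33_needs_Cstar_lt_consts_print {A₃ C lam Cstar ϑ : ℝ} (hA : 0 ≤ A₃) (hlam : 0.789401 ≤ lam)
    (hϑ : ϑ ≤ 4 / 9) (hCs : 1 ≤ Cstar)
    (hC : twinPrimeConst * romanovConst * (Cstar - 1) + Real.log 2 / 2 * (1 - ϑ) ≤ C)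
    (h : (A₃ + C * lam ^ (2 * 3 - 2)) * (A₃ + C * lam ^ (2 * 3 - 2)) < 1) : Cstar < 2.8644 :=
  crit33_needs_Cstar_lt_consts hA (le_trans (by norm_num) hlam) hϑ hCs hC h

end GoldbachLinnik

end Literature.NumberTheory.Sieve
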